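import Literature.AlgebraicTopology.SingularHomology.TransverseDiscFunctionalRelative
import HarnessLib

/-!
# Euclidean models for the sign of the slide: model classes generate; disc maps restricted to
# open balls are embeddings (Hatcher 2002, §3.3; for Milnor 1965, proof of Thm. 7.6, PDF p. 52)

Topic `Literature/Topology/FourManifolds`; bookkeeping bricks for the one-slide step of Milnor's
Basis Theorem 7.6 on a slab (`Literature.Topology.FourManifolds.Cobordism.Milnor1965_basisTheorem_slab_of_slideStep`,
`HCobordismBasisInduction.lean`): the incidences of the class of the slid disc `D_L'(p₁)` are
read in Euclidean models `e : V ≃ U ⊆ D'`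
(`Literature.AlgebraicTopology.SingularHomology.TransverseDiscDatum.functional_map_eq_smul_of_single`).

* `isGenerator_modelClass` — the model class `(U ⊆ T)⁎ (e)⁎ g_v` generates `Hₖ(T | e v)` when
  `e v` is interior to `U` (excision; as in `TransverseDiscDatum.exists_incidence`);
* `exists_int_modelClass_eq_smul` — hence any class of `Hₖ(T | e v)` is an integer multiple of it;
* `isEmbedding_restrict_ball` — a map continuous and injective on a closed ball of `ℝᵏ` into a
  Hausdorff space embeds every smaller open ball (the flat transverse disc and the cell
  parametrisation of the old disc restricted to open balls are Euclidean models).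

Everything here is proved; no definitions, no named facts.

## References

* A. Hatcher, *Algebraic Topology*, CUP 2002, Thm. 2.20, §3.3 pp. 233–236. [HatcherAT2002]
* J. Milnor, *Lectures on the h-cobordism theorem*, Princeton Mathematical Notes (1965),
  completion of the proof of Thm. 7.6 (PDF p. 52).  Held:
  `lit read book:milnornd-lectures-h-cobordism-theorem`. [MilnorHCobordism1965]
-/

noncomputable section

open CategoryTheory Set Function Filter Topology Metric
open Literature.AlgebraicTopology.SingularHomology

universe u

namespace Literature.Topology.FourManifolds

/-- **The model class generates.**  For a Euclidean model `e : V ≃ U ⊆ T` (`V ⊆ ℝᵏ` open) and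
`v ∈ V` with `e v` interior to `U`, the class `(U ⊆ T)⁎ (e)⁎ g_v` generates `Hₖ(T | e v) ≅ ℤ`
(excision at the interior point, Hatcher 2002, Thm. 2.20, and `Hₖ(ℝᵏ | v) = ℤ · g_v`).
[cite: HatcherAT2002, Thm. 2.20, §3.3 p. 236] -/
theorem isGenerator_modelClass {k : ℕ} (gE : HomologicalOrientation ℤ (EuclideanSpace ℝ (Fin k)) k)
    {T : Type u} [TopologicalSpace T] [T1Space T] {U : Set T}
    {V : Set (EuclideanSpace ℝ (Fin k))} (hV : IsOpen V) (e : ↥V ≃ₜ ↥U) (v : ↥V)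
    (hint : ((e v : ↥U) : T) ∈ interior U) :
    ∃ f : _ ≃ₗ[ℤ] ℤ, f (relativeSingularHomology.map ℤ ℤ (subsetIncl U)
      (localHomology.mapsTo_subsetIncl_compl (e v).2) k
        (localHomology.xEquiv ℤ ℤ e v k
          ((localHomology.openSubsetIso ℤ ℤ hV v.2 k).inv (gE.localClass (v : EuclideanSpace ℝ (Fin k)))))) = 1 := by
  have hG₀ : ∃ f : _ ≃ₗ[ℤ] ℤ, f ((localHomology.openSubsetIso ℤ ℤ hV v.2 k).inv
      (gE.localClass (v : EuclideanSpace ℝ (Fin k)))) = 1 := by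
    obtain ⟨f, hf⟩ := gE.isGenerator (v : EuclideanSpace ℝ (Fin k))
    refine ⟨(localHomology.openSubsetIso ℤ ℤ hV v.2 k).toLinearEquiv.trans f, ?_⟩
    rw [LinearEquiv.trans_apply, Iso.toLinearEquiv_apply, ← ModuleCat.comp_apply, Iso.inv_hom_id,
      ModuleCat.id_apply, hf]
  have hG : ∃ f : _ ≃ₗ[ℤ] ℤ, f (localHomology.xEquiv ℤ ℤ e v k
      ((localHomology.openSubsetIso ℤ ℤ hV v.2 k).inv (gE.localClass (v : EuclideanSpace ℝ (Fin k))))) = 1 :=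
    exists_linearEquiv_apply_eq_one_of_linearEquiv (localHomology.xEquiv ℤ ℤ e v k) hG₀
  haveI : IsIso (relativeSingularHomology.map ℤ ℤ (subsetIncl U)
      (localHomology.mapsTo_subsetIncl_compl (e v).2) k) :=
    localHomology.isIso_map_subsetIncl_of_mem_interior ℤ ℤ hint k
  exact exists_linearEquiv_apply_eq_one_of_linearEquiv
    (asIso (relativeSingularHomology.map ℤ ℤ (subsetIncl U)
      (localHomology.mapsTo_subsetIncl_compl (e v).2) k)).toLinearEquiv hG

/-- **Every class of `Hₖ(T | e v)` is an integer multiple of the model class** (`e v` interior to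
`U`). [cite: HatcherAT2002, Thm. 2.20, §3.3 p. 236] -/
theorem exists_int_eq_smul_modelClass {k : ℕ} (gE : HomologicalOrientation ℤ (EuclideanSpace ℝ (Fin k)) k)
    {T : Type u} [TopologicalSpace T] [T1Space T] {U : Set T}
    {V : Set (EuclideanSpace ℝ (Fin k))} (hV : IsOpen V) (e : ↥V ≃ₜ ↥U) (v : ↥V)
    (hint : ((e v : ↥U) : T) ∈ interior U) (x : localHomology ℤ ℤ T ((e v : ↥U) : T) k) :
    ∃ θ : ℤ, x = θ • relativeSingularHomology.map ℤ ℤ (subsetIncl U)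
      (localHomology.mapsTo_subsetIncl_compl (e v).2) k
        (localHomology.xEquiv ℤ ℤ e v k
          ((localHomology.openSubsetIso ℤ ℤ hV v.2 k).inv (gE.localClass (v : EuclideanSpace ℝ (Fin k))))) := by
  obtain ⟨f, hf⟩ := isGenerator_modelClass gE hV e v hint
  exact ⟨f x, eq_smul_of_linearEquiv_apply_eq_one f hf x⟩

/-- **A map continuous and injective on a closed ball embeds every smaller open ball** (closed
embedding of the compact ball into a Hausdorff space, restricted to an open subset). [folklore] -/
theorem isEmbedding_restrict_ball {k : ℕ} {Y : Type u} [TopologicalSpace Y] [T2Space Y]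
    (m : EuclideanSpace ℝ (Fin k) → Y) {r r' : ℝ} (hm : ContinuousOn m (closedBall 0 r))
    (hmi : InjOn m (closedBall 0 r)) (hr'r : r' ≤ r) :
    IsEmbedding fun v : ↥(ball (0 : EuclideanSpace ℝ (Fin k)) r') => m v := by
  haveI : CompactSpace ↥(closedBall (0 : EuclideanSpace ℝ (Fin k)) r) :=
    isCompact_iff_compactSpace.1 (isCompact_closedBall _ _)
  have hc : Continuous fun v : ↥(closedBall (0 : EuclideanSpace ℝ (Fin k)) r) => m v :=
    continuousOn_iff_continuous_restrict.1 hm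
  have hi : Function.Injective fun v : ↥(closedBall (0 : EuclideanSpace ℝ (Fin k)) r) => m v :=
    fun v w h => Subtype.ext (hmi v.2 w.2 h)
  have hcl : IsClosedEmbedding fun v : ↥(closedBall (0 : EuclideanSpace ℝ (Fin k)) r) => m v :=
    hc.isClosedEmbedding hi
  have hsub : ball (0 : EuclideanSpace ℝ (Fin k)) r' ⊆ closedBall 0 r :=
    ball_subset_closedBall.trans (closedBall_subset_closedBall hr'r)
  exact hcl.isEmbedding.comp (IsEmbedding.inclusion hsub)

end Literature.Topology.FourManifolds

end
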